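import Summits.QuantumFields.YangMills.Theorems.DiagonalMirrorRPRWilsonDiagonalModelSliceFields

/-!
# Crux `WeakCouplingHypercubicLimitRP` (stmt-QuantumFields-27398) / aside `DiagonalMirrorRPR` (stmt-QuantumFields-10604), door B,
# construction F1_diag — step A: ★★★ `def wilsonDiagonalModel r sch hβ : DiagonalSliceModel r sch` (the Wilson diagonal transfer model)

Helper file (`--supports stmt-QuantumFields-27398 --as helper`) of the hand `hand-10604-wilsonDiagModel-2` (docket director-ym O4 WORD 3 (A) / 16 (1) /
28: "deliver `stub_wilsonDiagonalModel` as a DEFINITION"), closing the programme of hand-10604-wilsonDiagModel-1 (kernel, operator, trace formula,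
spectral data: 26 files) and hand-10604-wilsonDiagModel-2 (pairing layer: P1–P4).  It closes nothing by itself: the door-B letters R1 `OddTwistGap`
and R2 `DiagLukewarm` (`…TwistLettersDefs`) are now statements ABOUT THIS MODEL and remain unproved.

WHAT.
* `sliceFields r sch hβ k : SliceFields r sch k` — at every scheme index the slice theorem `nonempty_sliceFields` (chosen) when `side_k ≥ 3`, the dummy
  slice at the finitely many indices with `side_k < 3` (all `F`-dependent interface fields are `∀ᶠ k`, and the regime forces `side_k ≥ 6`);
* ★★★ **`wilsonDiagonalModel r sch hβ : DiagonalSliceModel r sch`** — for Wilson's measure with `β_k ≥ 0` on the scheme's own odd tori: `sp k, sm k` = the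
  moduli of the positive / negative eigenvalues of hand-1's compact self-adjoint realisation `𝔄_k` (feature lift + reweighting of the two-step
  diagonal transfer matrix `K_u` in the symmetric light-cone chart), padded by zeros; `top k` its top modulus; the trace identities
  `Σ sp^m + (-1)^m Σ sm^m = Tr K_u^m` give `trace_nonneg`, `trace_side_pos`; for a reflected family `F`: `depth F k = d_k + 2` with `d_k` hand-2's slab
  depth, `wp F k, wm F k` = the Gram weights `κᵢ² ⟪bᵢ, 𝒲_{F,k} bᵢ⟫` of the block operator of `Y_k(F)` on the two sign sectors; `pairing_eq` and
  `weight_dom` are the one-insertion trace formula at chain lengths `S_k` and `2t + 2d_k + 4` with Osterwalder–Seiler positivity `𝒲 = 𝒯†𝒯`;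
* `nonempty_diagonalSliceModel` — the registered shadow `Nonempty (DiagonalSliceModel r sch)` of the core's `stub_wilsonDiagonalModel`, by `exact ⟨_⟩`.

HONEST FRAMING: this inhabits the INTERFACE by the genuine Wilson construction; it proves NO letter (R1/R2 are the physics: 45°-anisotropy of the
odd sector and lukewarmness), does not touch D1 / ⟨27398⟩ / S6i / the aside ⟨10604⟩, and bears on the summit only through those open letters;
the Yang–Mills mass gap is NOT proved here or anywhere in the tree.  No instance, no notation, `autoImplicit false`.

References: K. Osterwalder, E. Seiler, Ann. Phys. 110 (1978) §2–3; E. Seiler, LNP 159 (1982) Ch. 2; M. Reed, B. Simon I (1980) §VI.6; B. Simon,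
*Trace Ideals* (2005) Ch. 3.
-/

set_option autoImplicit false

noncomputable section

open scoped BigOperators
open MeasureTheory Function Filter Topology
open Literature.MathematicalPhysics.QuantumLattice Literature.MathematicalPhysics.QuantumFieldTheory
open Summit.QuantumFields.YangMills.Cruxes.DiagonalMirrorRPR.ParityBridgeColdTraces

namespace Summit.QuantumFields.YangMills.Cruxes.DiagonalMirrorRPR.SignTwistedDiagonalTrace.WilsonDiagonal

section Model

variable {G : Type} [Group G] [TopologicalSpace G] [IsTopologicalGroup G] [CompactSpace G] [MeasurableSpace G] [BorelSpace G]
  (r : LatticeRep G) (sch : SpeciesScheme (YMSpecies G))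

/-- **The slice fields at every scheme index**: the genuine slice (`nonempty_sliceFields`, chosen) when `side_k ≥ 3`, the dummy slice at the
finitely many indices with `side_k < 3`. -/
def sliceFields (hβ : ∀ k, 0 ≤ sch.β k) (k : ℕ) : SliceFields r sch k :=
  if h : 3 ≤ sch.side k then Classical.choice (nonempty_sliceFields r sch k (hβ k) h)
  else dummySliceFields r sch k (not_le.1 h)

/-- ★★★ **The Wilson diagonal transfer model** `wilsonDiagonalModel r sch hβ : DiagonalSliceModel r sch` (`β_k ≥ 0`): the two-sector spectral model of
the self-adjoint realisation of the two-step diagonal transfer matrix of Wilson's measure on the scheme's own odd tori, with the Gram weights,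
depth, pairing identity and weight domination of every reflected family (F1_diag; director-ym O4 WORD 3 (A)). -/
def wilsonDiagonalModel (hβ : ∀ k, 0 ≤ sch.β k) : DiagonalSliceModel r sch where
  sp k := (sliceFields r sch hβ k).sp
  sm k := (sliceFields r sch hβ k).sm
  top k := (sliceFields r sch hβ k).top
  top_pos k := (sliceFields r sch hβ k).top_pos
  sp_nonneg k := (sliceFields r sch hβ k).sp_nonneg
  sm_nonneg k := (sliceFields r sch hβ k).sm_nonneg
  sp_le k := (sliceFields r sch hβ k).sp_le
  sm_le k := (sliceFields r sch hβ k).sm_le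
  top_attained k := (sliceFields r sch hβ k).top_attained
  summable_sp k := (sliceFields r sch hβ k).summable_sp
  summable_sm k := (sliceFields r sch hβ k).summable_sm
  trace_nonneg k := (sliceFields r sch hβ k).trace_nonneg
  trace_side_pos k := (sliceFields r sch hβ k).trace_side_pos
  wp F k := (sliceFields r sch hβ k).wp F
  wm F k := (sliceFields r sch hβ k).wm F
  wp_nonneg F k := (sliceFields r sch hβ k).wp_nonneg F
  wm_nonneg F k := (sliceFields r sch hβ k).wm_nonneg F
  w_bdd F k := (sliceFields r sch hβ k).w_bdd F
  depth F k := famDepthSeq r sch F k + 2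
  depth_le F := by
    obtain ⟨R, hR⟩ := exists_a_mul_famDepthSeq_add_two_le r sch F
    exact ⟨R, hR⟩
  pairing_eq F := by
    filter_upwards [eventually_goodStep r sch F] with k hk
    exact ⟨by omega, (sliceFields r sch hβ k).pairing F hk.1 hk.2⟩
  weight_dom F := by
    filter_upwards [eventually_goodStep r sch F] with k hk
    intro t B hB
    exact (sliceFields r sch hβ k).dom F hk.1 hk.2 t B hB

/-- **The registered shadow of the core's `stub_wilsonDiagonalModel`** (`Cruxes/DiagonalMirrorRPR/Lines/sign_twisted_diagonal_trace_core.lean`):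
`Nonempty (DiagonalSliceModel r sch)` for `β_k ≥ 0`, by the construction. -/
theorem nonempty_diagonalSliceModel (hβ : ∀ k, 0 ≤ sch.β k) : Nonempty (DiagonalSliceModel r sch) :=
  ⟨wilsonDiagonalModel r sch hβ⟩

/-- The model's depth of a reflected family is hand-2's slab depth plus two (block half-width `d_k + 1`, plus one for the `κ²` in the weights). -/
theorem wilsonDiagonalModel_depth (hβ : ∀ k, 0 ≤ sch.β k) (F : ReflectedFamily) (k : ℕ) :
    (wilsonDiagonalModel r sch hβ).depth F k = famDepthSeq r sch F k + 2 := rfl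

/-- At every index with `side_k ≥ 3` the model's slice is the genuine Wilson slice (`nonempty_sliceFields`), not the dummy. -/
theorem sliceFields_eq_choice (hβ : ∀ k, 0 ≤ sch.β k) (k : ℕ) (h : 3 ≤ sch.side k) :
    sliceFields r sch hβ k = Classical.choice (nonempty_sliceFields r sch k (hβ k) h) := by
  unfold sliceFields
  rw [dif_pos h]

omit [TopologicalSpace G] [IsTopologicalGroup G] [CompactSpace G] [BorelSpace G] in
/-- `side_k ≥ 3` eventually (the volume diverges), so eventually every slice of the model is the genuine Wilson slice. -/
theorem eventually_three_le_side : ∀ᶠ k in atTop, 3 ≤ sch.side k := by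
  have h := tendsto_a_mul_side' sch
  have ha1 : ∀ᶠ k in atTop, sch.a k ≤ 1 := ((tendsto_order.1 sch.tendsto_a).2 1 one_pos).mono fun k hk => hk.le
  filter_upwards [ha1, h.eventually_gt_atTop 3] with k hk1 hk3
  have ha := sch.a_pos k
  by_contra hlt
  push Not at hlt
  have : sch.a k * (sch.side k : ℝ) < 3 := by
    calc sch.a k * (sch.side k : ℝ) ≤ 1 * (sch.side k : ℝ) := by gcongr
      _ < 3 := by rw [one_mul]; exact_mod_cast hlt
  linarith

end Model

end Summit.QuantumFields.YangMills.Cruxes.DiagonalMirrorRPR.SignTwistedDiagonalTrace.WilsonDiagonal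

end
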